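import Mathlib
import Summits.ValiantsHypothesis.ValiantsHypothesis.Theses.NewtonUnitEquations
import Summits.ValiantsHypothesis.ValiantsHypothesis.Theorems.NewtonUnitEquationsDissociatedUniformQuasiPoly

/-!
# Line `dissociated-weak` — SPECIAL FILE (floor witness + on-path step), sorry-free

Companion of `Cruxes/FewProductsBound/Lines/dissociated_weak.lean` (ladder-down on crux
`NewtonUnitEquations.FewProductsBound`, stmt-ValiantsHypothesis-16052).  Self-contained (does not import the line
file): the graded family `DRung κ` is restated verbatim and two facts are proved WITHOUT sorry:

* `floor` — the FLOOR RUNG `DRung (m ↦ m / (⌈log₂ m⌉ + 1))` (few-products bound on dissociated frames in the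
  uniformity range `k ≤ 2^(m/(log m + 1))`, constants `a = 12`, `b = 1`) from Theorem Q
  (`dissociated_quasiPoly`, landed p94717).  This is the BC5 / T3 witness of weakness for the rung
  `DRung id = DissociatedFewProducts`: a theorem of the rung's exact shape, one parameter value below it, in a
  regime (`k` up to `2^(m / log m)`, unbounded `t`, arbitrary design-like dissociated frames) where neither the crux
  nor the summit is known.
* `onPath` — crux ⟹ rung (`FewProductsBound → DRung id`): the rung is ON the path (a consequence of the crux).
-/

set_option linter.dupNamespace false

namespace Summit.ValiantsHypothesis.ValiantsHypothesis.Cruxes.FewProductsBound.DissociatedWeak.Special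

open scoped BigOperators
open Summit.ValiantsHypothesis.ValiantsHypothesis.Theses.NewtonUnitEquations (FewProductsBound)
open Summit.ValiantsHypothesis.ValiantsHypothesis.Theorems.NewtonUnitEquationsDissociatedUniform

/-- The graded rung (verbatim copy of `DissociatedWeak.DRung`). -/
def DRung (κ : ℕ → ℕ) : Prop :=
  ∃ a b : ℕ, ∀ (k m t : ℕ) (A : Fin m → Finset (Fin 2 →₀ ℕ)) (f : Fin k → Fin m → MvPolynomial (Fin 2) ℂ),
    k ≤ 2 ^ κ m → (∀ j, (A j).card ≤ t) → (∀ i j, (f i j).support ⊆ A j) →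
    (∀ a b : Fin m → (Fin 2 →₀ ℕ), (∀ j, a j ∈ A j) → (∀ j, b j ∈ A j) → ∑ j, a j = ∑ j, b j → a = b) →
    (Set.extremePoints ℝ (convexHull ℝ ((fun e : Fin 2 →₀ ℕ => fun i : Fin 2 => ((e i : ℕ) : ℝ)) ''
      ((∑ i, ∏ j, f i j).support : Set (Fin 2 →₀ ℕ))))).ncard ≤ 2 ^ (a * m) * (t + 2) ^ b

/-- Arithmetic of the Khatri–Rao factor: `k ≤ 2^q → (8 (k+2)³)^c ≤ 2^((3q+9) c)`. -/
theorem khatriRao_factor_le (k q c : ℕ) (hk : k ≤ 2 ^ q) : (8 * (k + 2) ^ 3) ^ c ≤ 2 ^ ((3 * q + 9) * c) := by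
  have hP : 1 ≤ 2 ^ q := Nat.one_le_two_pow
  have h1 : k + 2 ≤ 2 ^ (q + 2) := by
    have : 2 ^ (q + 2) = 2 ^ q * 4 := by rw [pow_add]; norm_num
    omega
  have h2 : 8 * (k + 2) ^ 3 ≤ 2 ^ (3 * q + 9) := by
    calc 8 * (k + 2) ^ 3 ≤ 8 * (2 ^ (q + 2)) ^ 3 := Nat.mul_le_mul_left _ (Nat.pow_le_pow_left h1 3)
      _ = 2 ^ (3 * q + 9) := by ring
  calc (8 * (k + 2) ^ 3) ^ c ≤ (2 ^ (3 * q + 9)) ^ c := Nat.pow_le_pow_left h2 c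
    _ = 2 ^ ((3 * q + 9) * c) := by rw [← pow_mul]

/-- **FLOOR RUNG (witness of weakness, PROVED).**  `DRung (m ↦ m / (⌈log₂ m⌉ + 1))` with `a = 12`, `b = 1`. -/
theorem floor : DRung (fun m => m / (Nat.clog 2 m + 1)) := by
  refine ⟨12, 1, ?_⟩
  intro k m t A f hk hcard hsupp hdis
  change k ≤ 2 ^ (m / (Nat.clog 2 m + 1)) at hk
  have hQ := dissociated_quasiPoly k m t A f hcard hsupp hdis
  set c := Nat.clog 2 m with hc
  have hfac := khatriRao_factor_le k (m / (c + 1)) c hk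
  have hqc : (m / (c + 1)) * c ≤ m :=
    calc (m / (c + 1)) * c ≤ (m / (c + 1)) * (c + 1) := Nat.mul_le_mul_left _ (Nat.le_succ c)
      _ ≤ m := Nat.div_mul_le_self m (c + 1)
  have hcm : c ≤ m := (Nat.clog_le_iff_le_pow one_lt_two).mpr Nat.lt_two_pow_self.le
  have hexp : (3 * (m / (c + 1)) + 9) * c ≤ 12 * m := by
    have h3 := Nat.mul_le_mul_left 3 hqc
    have h9 := Nat.mul_le_mul_left 9 hcm
    calc (3 * (m / (c + 1)) + 9) * c = 3 * ((m / (c + 1)) * c) + 9 * c := by ring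
      _ ≤ 3 * m + 9 * m := Nat.add_le_add h3 h9
      _ = 12 * m := by ring
  calc _ ≤ (t + 2) * (8 * (k + 2) ^ 3) ^ c := hQ
    _ ≤ (t + 2) * 2 ^ ((3 * (m / (c + 1)) + 9) * c) := Nat.mul_le_mul_left _ hfac
    _ ≤ (t + 2) * 2 ^ (12 * m) := Nat.mul_le_mul_left _ (Nat.pow_le_pow_right (by norm_num) hexp)
    _ = 2 ^ (12 * m) * (t + 2) ^ 1 := by ring

/-- **ON-PATH (PROVED).**  The crux implies the rung `DRung id` (drop the frame hypothesis). -/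
theorem onPath (h : FewProductsBound) : DRung id := by
  obtain ⟨a, b, h⟩ := h
  refine ⟨a, b, fun k m t A f hk hcard hsupp hdis => h k m t f hk fun i j => ?_⟩
  exact (Finset.card_le_card (hsupp i j)).trans (hcard j)

end Summit.ValiantsHypothesis.ValiantsHypothesis.Cruxes.FewProductsBound.DissociatedWeak.Special
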